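import Summits.Schanuel.Schanuel.Theorems.RootDecomp1BFinitePinningFloor02

/-!
# `RootDecomp1BFinitePinningFloor` — part 03 of 04 (`RootDecomp1BFinitePinningFloor03`): §5 Baker for the logarithms of the primes (`linearIndependent_logPrime_A`), `exists_pow_pi_not_mem`, `exists_logPrime_not_mem`, functionals on `ℝ ⧸ F` (`exists_phi_of_not_mem`), `exists_pinned_shear`; §6 `AgreesOn`, the fixed hyperplane (`fixedSpace`, `fixedSpace_sup_span_u`), `hyperplanePinningFloor`, `finitePinningFloor`, `finiteSetPinningFloor`, `…_periodPackage`, the headline `_false_without_` theorems (`schanuelRank_two_false_without_channel_beyond_periods`, `kleinPolarSchanuel_false_without_channel_beyond_kernel_and_period_plane`, `…_beyond_finite_pinning`, `…_beyond_hyperplane_pinning`, `finitePinning_exp_dictionary`)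

Part 3 of the port of the lens-4 gen-23 kernel `FinitePinningFloor.lean` (see part 01 for the overview, the construction of pinned shears and the reading for the crux). PORT in four parts (≤ 400 lines each, shared namespace `Summit.Schanuel.Schanuel.Theorems.RootDecomp1BFinitePinningFloor`, each part importing the previous; `--supports stmt-Schanuel-24622`) of the decomp-schanuel lens-4 kernel file `HOME/decomp-schanuel-lens-4/g23/FinitePinningFloor.lean` (gen 23, 2026-08-30, sha256 be17678cd9687711…; `lean check` rc 0 · 0 sorry · standard axioms). 
-/

noncomputable section

open Complex

namespace Summit.Schanuel.Schanuel.Theorems.RootDecomp1BFinitePinningFloor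

open Summit.Schanuel.Schanuel.Theorems.RootDecomp1BTranscendencePackageFloor
open Summit.Schanuel.Schanuel.Theorems.RootDecomp1BPeriodKernelFloor
open Literature.NumberTheory.Transcendental (nesterenko baker_holds SchanuelRank transcendental_pi_holds)

/-! ## §5 Logarithms of primes are `A`-linearly independent (unique factorisation + Baker);
a pinned shear killing any given finite-dimensional `F ∋ 1, π` exists -/

/-- `log p_j`, `p_j` the `j`-th prime (`j = 0, 1, 2, …`). [folklore] -/
def logPrime (j : ℕ) : ℝ := Real.log (Nat.nth Nat.Prime j : ℕ)

/-- `j ↦ p_j` is injective on `Fin n`. [folklore] -/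
theorem injective_nthPrimes (n : ℕ) : Function.Injective
    (fun j : Fin n => (⟨Nat.nth Nat.Prime j, Nat.prime_nth_prime j⟩ : Nat.Primes)) := by
  intro i j hij
  have h := congrArg Subtype.val hij
  exact Fin.ext (Nat.nth_injective Nat.infinite_setOf_prime h)

/-- `log p_0, …, log p_{n-1}` are `ℚ`-linearly independent (unique factorisation; the tree's
`Literature.AlgebraicGeometry.Frobenioids.linearIndependent_rat_log_primes`).
[cite: MochizukiFrdI2008, Lem. 6.5 (i) p.116] -/
theorem linearIndependent_logPrime_rat (n : ℕ) : LinearIndependent ℚ fun j : Fin n => logPrime j := by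
  have hli := Literature.AlgebraicGeometry.Frobenioids.linearIndependent_rat_log_primes.comp _
    (injective_nthPrimes n)
  have e : (fun j : Fin n => logPrime j) =
      (fun p : Nat.Primes => Real.log (p : ℕ)) ∘
        (fun j : Fin n => (⟨Nat.nth Nat.Prime j, Nat.prime_nth_prime j⟩ : Nat.Primes)) := by
    funext j
    rfl
  rw [e]
  exact hli

/-- … hence, as complex numbers, `ℚ`-linearly independent. [cite: MochizukiFrdI2008, Lem. 6.5 (i) p.116] -/
theorem linearIndependent_logPrime_complex (n : ℕ) :
    LinearIndependent ℚ fun j : Fin n => ((logPrime j : ℝ) : ℂ) := by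
  rw [Fintype.linearIndependent_iff]
  intro g hg
  have hre := congrArg Complex.re hg
  rw [Complex.re_sum, Complex.zero_re] at hre
  simp only [Rat.smul_def, Complex.mul_re, Complex.ratCast_re, Complex.ratCast_im,
    Complex.ofReal_re, Complex.ofReal_im, mul_zero, sub_zero] at hre
  refine Fintype.linearIndependent_iff.mp (linearIndependent_logPrime_rat n) g ?_
  rw [← hre]
  refine Finset.sum_congr rfl fun j _ => ?_
  rw [Rat.smul_def]

/-- BAKER: `log p_0, …, log p_{n-1}` are linearly independent over `A = ℚ̄ ∩ ℝ` (Baker's theorem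
at the `ℚ`-free logarithms `log p_j` of the algebraic numbers `p_j`). [cite: Baker1966, 68] -/
theorem linearIndependent_logPrime_A (n : ℕ) : LinearIndependent A fun j : Fin n => logPrime j := by
  classical
  let l : Fin n → ℂ := fun j => ((logPrime j : ℝ) : ℂ)
  have halg : ∀ j, IsAlgebraic ℚ (cexp (l j)) := by
    intro j
    have h : cexp (l j) = ((Nat.nth Nat.Prime j : ℕ) : ℂ) :=
      cexp_log_natCast (Nat.prime_nth_prime j).pos
    rw [h]
    exact isAlgebraic_nat _
  have hB := baker_holds l halg (linearIndependent_logPrime_complex n)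
  have hBl : LinearIndependent Qb l := hB.comp some (Option.some_injective _)
  rw [Fintype.linearIndependent_iff]
  intro c hc
  let g : Fin n → Qb := fun j => ⟨((c j : ℝ) : ℂ), mem_A_iff_coe_mem_Qb.mp (c j).2⟩
  have hsum : ∑ j, g j • l j = 0 := by
    have h := congrArg ((↑) : ℝ → ℂ) hc
    rw [Complex.ofReal_sum, Complex.ofReal_zero] at h
    rw [← h]
    refine Finset.sum_congr rfl fun j _ => ?_
    rw [IntermediateField.smul_def, IntermediateField.smul_def, smul_eq_mul, smul_eq_mul,
      Complex.ofReal_mul]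
  have key := Fintype.linearIndependent_iff.mp hBl g hsum
  intro j
  have hj : ((c j : ℝ) : ℂ) = 0 := by
    have h := congrArg Subtype.val (key j)
    exact h
  have hj' : (c j : ℝ) = 0 := by exact_mod_cast hj
  exact_mod_cast hj'

/-- Some power `π^k` lies outside any finite-dimensional `A`-subspace `F` of `ℝ`
(the powers of `π` are `A`-independent). [cite: Lindemann1882, via BakerTNT1975 Ch. 1 Theorem 1.3, p. 5] -/
theorem exists_pow_pi_not_mem (F : Submodule A ℝ) [Module.Finite A F] : ∃ k : ℕ, Real.pi ^ k ∉ F := by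
  by_contra! hall
  let v : Fin (Module.finrank A F + 1) → F := fun k => ⟨Real.pi ^ (k : ℕ), hall k⟩
  have hv : LinearIndependent A v := by
    refine LinearIndependent.of_comp F.subtype ?_
    exact linearIndependent_pi_pow_A (fun k : Fin (Module.finrank A F + 1) => (k : ℕ))
      Fin.val_injective
  have h := hv.fintype_card_le_finrank
  rw [Fintype.card_fin] at h
  omega

/-- Some `log p`, `p` prime, lies outside any finite-dimensional `A`-subspace `G` of `ℝ` (Baker).
[cite: Baker1966, 68] -/
theorem exists_logPrime_not_mem (G : Submodule A ℝ) [Module.Finite A G] : ∃ j : ℕ, logPrime j ∉ G := by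
  by_contra! hall
  let v : Fin (Module.finrank A G + 1) → G := fun j => ⟨logPrime j, hall j⟩
  have hv : LinearIndependent A v := by
    refine LinearIndependent.of_comp G.subtype ?_
    exact linearIndependent_logPrime_A _
  have h := hv.fintype_card_le_finrank
  rw [Fintype.card_fin] at h
  omega

/-- Functionals with prescribed values on an `A`-free family, in any `A`-vector space.
[linear algebra] [folklore] -/
theorem exists_functional' {V : Type*} [AddCommGroup V] [Module A V] {ι : Type*} {v : ι → V}
    (hv : LinearIndependent A v) (c : ι → A) : ∃ φ : V →ₗ[A] A, ∀ i, φ (v i) = c i := by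
  classical
  obtain ⟨g, hg⟩ := LinearMap.exists_extend ((Finsupp.linearCombination A c).comp hv.repr)
  refine ⟨g, fun i => ?_⟩
  have hmem : v i ∈ Submodule.span A (Set.range v) := Submodule.subset_span ⟨i, rfl⟩
  have h1 := LinearMap.congr_fun hg ⟨v i, hmem⟩
  simp only [LinearMap.coe_comp, Function.comp_apply, Submodule.coe_subtype] at h1
  rw [h1, hv.repr_eq_single i ⟨v i, hmem⟩ rfl, Finsupp.linearCombination_single, one_smul]

/-- A functional KILLING `F` with `φ u = φ ℓ = 1`, for `u ∉ F` and `ℓ ∉ F + A·u` (functionals on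
the quotient `ℝ ⧸ F`). [linear algebra] [folklore] -/
theorem exists_phi_of_not_mem (F : Submodule A ℝ) {u ℓ : ℝ} (hu : u ∉ F)
    (hℓ : ℓ ∉ F ⊔ Submodule.span A {u}) :
    ∃ φ : ℝ →ₗ[A] A, (∀ x ∈ F, φ x = 0) ∧ φ u = 1 ∧ φ ℓ = 1 := by
  have hli : LinearIndependent A ![F.mkQ u, F.mkQ ℓ] := by
    rw [LinearIndependent.pair_iff]
    intro s t hst
    rw [← map_smul, ← map_smul, ← map_add, Submodule.mkQ_apply, Submodule.Quotient.mk_eq_zero] at hst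
    have ht : t = 0 := by
      by_contra ht
      apply hℓ
      have e : ℓ = t⁻¹ • ((s • u + t • ℓ) - s • u) := by
        rw [add_sub_cancel_left, smul_smul, inv_mul_cancel₀ ht, one_smul]
      rw [e]
      exact Submodule.smul_mem _ _ (Submodule.sub_mem _ (Submodule.mem_sup_left hst)
        (Submodule.mem_sup_right (Submodule.smul_mem _ _ (Submodule.mem_span_singleton_self u))))
    subst ht
    rw [zero_smul, add_zero] at hst
    have hs : s = 0 := by
      by_contra hs
      apply hu
      have e : u = s⁻¹ • (s • u) := by rw [smul_smul, inv_mul_cancel₀ hs, one_smul]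
      rw [e]
      exact Submodule.smul_mem _ _ hst
    exact ⟨hs, rfl⟩
  obtain ⟨ψ, hψ⟩ := exists_functional' hli ![1, 1]
  refine ⟨ψ.comp F.mkQ, fun x hx => ?_, by simpa using hψ 0, by simpa using hψ 1⟩
  rw [LinearMap.comp_apply, Submodule.mkQ_apply, (Submodule.Quotient.mk_eq_zero F).mpr hx, map_zero]

/-- **PINNED SHEARS EXIST for every finite-dimensional `F ∋ 1, π`**: a shear `(φ, u = π^k, ℓ = log p)`
with `φ|_F = 0`, `k ≠ 1`, `p` prime and `d = ℓ − u ≠ 0`. [cite: Baker1966, 68] -/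
theorem exists_pinned_shear (F : Submodule A ℝ) [Module.Finite A F] (h1 : (1 : ℝ) ∈ F)
    (hπ : Real.pi ∈ F) :
    ∃ (S : Shear) (k p : ℕ), (∀ x ∈ F, S.φ x = 0) ∧ S.u = Real.pi ^ k ∧ k ≠ 1 ∧ p.Prime ∧
      S.ℓ = Real.log p ∧ S.d ≠ 0 := by
  obtain ⟨k, hk⟩ := exists_pow_pi_not_mem F
  obtain ⟨j, hj⟩ := exists_logPrime_not_mem (F ⊔ Submodule.span A {Real.pi ^ k})
  obtain ⟨φ, hF, hu, hℓ⟩ := exists_phi_of_not_mem F hk hj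
  refine ⟨⟨φ, Real.pi ^ k, logPrime j, hF 1 h1, hu, by rw [hℓ]; exact one_ne_zero⟩, k,
    Nat.nth Nat.Prime j, hF, rfl, ?_, Nat.prime_nth_prime j, rfl, ?_⟩
  · rintro rfl
    rw [pow_one] at hk
    exact hk hπ
  · show logPrime j - Real.pi ^ k ≠ 0
    intro h0
    apply hj
    rw [sub_eq_zero.mp h0]
    exact Submodule.mem_sup_right (Submodule.mem_span_singleton_self _)

/-! ## §6 The FINITE / HYPERPLANE PINNING FLOOR and the headline `_false_without_` statements -/

/-- AGREEMENT WITH `exp` ON `F ⊕ iF` (`{z : re z ∈ F, im z ∈ F}`) for a real `A`-subspace `F`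
(the name is ours). [folklore] -/
def AgreesOn (E : ℂ → ℂ) (F : Submodule A ℝ) : Prop :=
  ∀ z : ℂ, z.re ∈ F → z.im ∈ F → E z = cexp z

/-- `exp` agrees with itself. [folklore] -/
theorem agreesOn_exp (F : Submodule A ℝ) : AgreesOn cexp F := fun _ _ _ => rfl

/-- Agreement is inherited by smaller subspaces. [folklore] -/
theorem AgreesOn.mono {E : ℂ → ℂ} {F G : Submodule A ℝ} (h : AgreesOn E G) (hFG : F ≤ G) :
    AgreesOn E F := fun z hre him => h z (hFG hre) (hFG him)

/-- The FIXED SPACE `H_S = ker φ ⊂ ℝ` of a shear (an `A`-subspace). [folklore] -/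
def fixedSpace (S : Shear) : Submodule A ℝ := LinearMap.ker S.φ

/-- `x ∈ H_S ↔ φ x = 0`. [folklore] -/
theorem mem_fixedSpace {S : Shear} {x : ℝ} : x ∈ fixedSpace S ↔ S.φ x = 0 := LinearMap.mem_ker

/-- A shear's exponential AGREES with `exp` on `H_S ⊕ iH_S`. [folklore] -/
theorem agreesOn_fixedSpace (S : Shear) : AgreesOn S.E (fixedSpace S) := fun z hre him => by
  rw [← Complex.re_add_im z]
  exact E_eq_exp_of S (mem_fixedSpace.mp hre) (mem_fixedSpace.mp him)

/-- `u ∉ H_S`. [folklore] -/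
theorem u_not_mem_fixedSpace (S : Shear) : S.u ∉ fixedSpace S := by
  rw [mem_fixedSpace, S.φ_u]
  exact one_ne_zero

/-- `H_S ≠ ℝ`. [folklore] -/
theorem fixedSpace_ne_top (S : Shear) : fixedSpace S ≠ ⊤ := fun h =>
  u_not_mem_fixedSpace S (h ▸ Submodule.mem_top)

/-- `ℝ = H_S + A·u`: the fixed space is an `A`-HYPERPLANE of `ℝ`. [folklore] -/
theorem fixedSpace_sup_span_u (S : Shear) : fixedSpace S ⊔ Submodule.span A {S.u} = ⊤ := by
  rw [eq_top_iff]
  intro x _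
  have hx : x = (x - S.φ x • S.u) + S.φ x • S.u := by rw [sub_add_cancel]
  rw [hx]
  refine Submodule.add_mem _ (Submodule.mem_sup_left ?_)
    (Submodule.mem_sup_right (Submodule.smul_mem _ _ (Submodule.mem_span_singleton_self _)))
  rw [mem_fixedSpace, map_sub, map_smul, S.φ_u, smul_eq_mul, mul_one, sub_self]

/-- `H_S ∩ A·u = 0`: the complement is direct. [folklore] -/
theorem fixedSpace_inf_span_u (S : Shear) : fixedSpace S ⊓ Submodule.span A {S.u} = ⊥ := by
  rw [eq_bot_iff]
  intro x hx
  obtain ⟨hH, hu⟩ := Submodule.mem_inf.mp hx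
  obtain ⟨a, rfl⟩ := Submodule.mem_span_singleton.mp hu
  rw [mem_fixedSpace, map_smul, S.φ_u, smul_eq_mul, mul_one] at hH
  rw [hH, zero_smul]
  exact Submodule.zero_mem _

/-- **PINNED SHEARS EXIST for every finite-dimensional `F`** (enlarge `F` by `1, π` first).
[cite: Baker1966, 68] -/
theorem exists_pinned_shear' (F : Submodule A ℝ) [Module.Finite A F] :
    ∃ (S : Shear) (k p : ℕ), (∀ x ∈ F, S.φ x = 0) ∧ S.φ Real.pi = 0 ∧ S.u = Real.pi ^ k ∧ k ≠ 1 ∧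
      p.Prime ∧ S.ℓ = Real.log p ∧ S.d ≠ 0 := by
  haveI : Module.Finite A (Submodule.span A ({(1 : ℝ), Real.pi} : Set ℝ)) :=
    Module.Finite.span_of_finite A (Set.toFinite _)
  have h1 : (1 : ℝ) ∈ F ⊔ Submodule.span A ({(1 : ℝ), Real.pi} : Set ℝ) :=
    Submodule.mem_sup_right (Submodule.subset_span (by simp))
  have hπ : Real.pi ∈ F ⊔ Submodule.span A ({(1 : ℝ), Real.pi} : Set ℝ) :=
    Submodule.mem_sup_right (Submodule.subset_span (by simp))
  obtain ⟨S, k, p, hF, hu, hk, hp, hℓ, hd⟩ := exists_pinned_shear _ h1 hπ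
  exact ⟨S, k, p, fun x hx => hF x (Submodule.mem_sup_left hx), hF _ hπ, hu, hk, hp, hℓ, hd⟩

/-- **HYPERPLANE PINNING FLOOR.** For EVERY finite-dimensional `A`-subspace `F ⊂ ℝ`
(`A = ℚ̄ ∩ ℝ`) there are an `A`-HYPERPLANE `H ⊇ F` of `ℝ` (`ℝ = H ⊕ A·u`) and an exponential `E`
on `ℂ` which AGREES with `exp` on `H ⊕ iH`, has the algebraic-point transcendence package
(E1)–(E4), the TRUE kernel `2πiℤ`, `E = exp` on the period plane `ℚ̄ ⊕ ℚ̄π`, Nesterenko's theorem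
verbatim (granted `nesterenko`) — and which is discontinuous and FAILS `SchanuelRank 2`, Klein-polar
Schanuel (at length `2`) and the summit text. [cite: Baker1966, 68] -/
theorem hyperplanePinningFloor (F : Submodule A ℝ) [Module.Finite A F] :
    ∃ (E : ℂ → ℂ) (H : Submodule A ℝ) (u : ℝ), F ≤ H ∧ H ≠ ⊤ ∧ H ⊔ Submodule.span A {u} = ⊤ ∧
      H ⊓ Submodule.span A {u} = ⊥ ∧ AgreesOn E H ∧
      TranscendencePackage E ∧ TrueKernel E ∧ AgreesOnPeriodPlane E ∧
      (nesterenko → NesterenkoE E) ∧ ¬ Continuous E ∧ ¬ Measurable (fun x : ℝ => E x) ∧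
      ¬ SchanuelRankE E 2 ∧ ¬ KleinPolarE E ∧ ¬ SchanuelE E := by
  obtain ⟨S, k, p, hF, hφπ, hu, hk, hp, hℓ, hd⟩ := exists_pinned_shear' F
  exact ⟨S.E, fixedSpace S, S.u, fun x hx => mem_fixedSpace.mpr (hF x hx), fixedSpace_ne_top S,
    fixedSpace_sup_span_u S, fixedSpace_inf_span_u S, agreesOn_fixedSpace S,
    transcendencePackage_shear S, trueKernel_of S hφπ, agreesOnPeriodPlane_of S hφπ,
    fun hN => nesterenkoE_of S hN hφπ, S.not_continuous_E hd, not_measurable_E_ofReal S hd,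
    not_schanuelRankE_two_of S hp.pos hφπ hu hℓ,
    not_kleinPolarE_of S hk hp.pos hφπ hu hℓ, not_schanuelE_of S hp.pos hφπ hu hℓ⟩

/-- **FINITE PINNING FLOOR.** For EVERY finite-dimensional `A`-subspace `F ⊂ ℝ` there is an
exponential `E` on `ℂ` with (E1)–(E4), the true kernel, the period plane, `E = exp` on `F ⊕ iF`,
Nesterenko verbatim (granted `nesterenko`), discontinuous, failing `SchanuelRank 2`, Klein-polar
Schanuel and the summit text. [cite: Baker1966, 68] -/
theorem finitePinningFloor (F : Submodule A ℝ) [Module.Finite A F] :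
    ∃ E : ℂ → ℂ, TranscendencePackage E ∧ TrueKernel E ∧ AgreesOnPeriodPlane E ∧ AgreesOn E F ∧
      (nesterenko → NesterenkoE E) ∧ ¬ Continuous E ∧ ¬ Measurable (fun x : ℝ => E x) ∧
      ¬ SchanuelRankE E 2 ∧ ¬ KleinPolarE E ∧ ¬ SchanuelE E := by
  obtain ⟨E, H, u, hFH, _, _, _, hA, h₁, h₂, h₃, h₄⟩ := hyperplanePinningFloor F
  exact ⟨E, h₁, h₂, h₃, hA.mono hFH, h₄⟩

/-- … for a prescribed FINITE SET `T` of reals: `E = exp` at every `z` with `re z, im z` in the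
`A`-span of `T` (so at `T`, `iT`, `T + iT`). [cite: Baker1966, 68] -/
theorem finiteSetPinningFloor {T : Set ℝ} (hT : T.Finite) :
    ∃ E : ℂ → ℂ, TranscendencePackage E ∧ TrueKernel E ∧ AgreesOnPeriodPlane E ∧
      (∀ z : ℂ, z.re ∈ Submodule.span A T → z.im ∈ Submodule.span A T → E z = cexp z) ∧
      (nesterenko → NesterenkoE E) ∧ ¬ Continuous E ∧ ¬ Measurable (fun x : ℝ => E x) ∧
      ¬ SchanuelRankE E 2 ∧ ¬ KleinPolarE E ∧ ¬ SchanuelE E := by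
  haveI : Module.Finite A (Submodule.span A T) := Module.Finite.span_of_finite A hT
  exact finitePinningFloor (Submodule.span A T)

/-- … with the PERIOD PACKAGE spelled out (granted Nesterenko). [cite: Nesterenko1996SbMath, Theorem 1 and its corollaries] -/
theorem finitePinningFloor_periodPackage (hN : nesterenko) (F : Submodule A ℝ) [Module.Finite A F] :
    ∃ E : ℂ → ℂ, PeriodPackage E ∧ AgreesOn E F ∧ ¬ Continuous E ∧ ¬ Measurable (fun x : ℝ => E x) ∧
      ¬ SchanuelRankE E 2 ∧ ¬ KleinPolarE E ∧ ¬ SchanuelE E := by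
  obtain ⟨E, h₁, h₂, h₃, h₄, h₅, h₆, hM, h₇, h₈, h₉⟩ := finitePinningFloor F
  exact ⟨E, ⟨h₁, h₂, h₃, h₅ hN⟩, h₄, h₆, hM, h₇, h₈, h₉⟩

/-- … hyperplane form with the PERIOD PACKAGE spelled out. [cite: Nesterenko1996SbMath, Theorem 1 and its corollaries] -/
theorem hyperplanePinningFloor_periodPackage (hN : nesterenko) (F : Submodule A ℝ)
    [Module.Finite A F] :
    ∃ (E : ℂ → ℂ) (H : Submodule A ℝ) (u : ℝ), F ≤ H ∧ H ≠ ⊤ ∧ H ⊔ Submodule.span A {u} = ⊤ ∧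
      AgreesOn E H ∧ PeriodPackage E ∧ ¬ Continuous E ∧ ¬ Measurable (fun x : ℝ => E x) ∧
      ¬ SchanuelRankE E 2 ∧ ¬ KleinPolarE E ∧ ¬ SchanuelE E := by
  obtain ⟨E, H, u, hFH, hne, hsup, _, hA, h₁, h₂, h₃, h₅, h₆, hM, h₇, h₈, h₉⟩ :=
    hyperplanePinningFloor F
  exact ⟨E, H, u, hFH, hne, hsup, hA, ⟨h₁, h₂, h₃, h₅ hN⟩, h₆, hM, h₇, h₈, h₉⟩

/-- **`SchanuelRank 2` is FALSE WITHOUT a channel beyond the period package** — the RANK COST OF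
THE PERIOD IS ZERO for `S`: `E₂` has (E1)–(E4) ∪ (P1)–(P3) and fails `S(2)` at `(iπ, π²)` (part
PKF02's `E₁` was only shown to fail `S(3)`). [cite: Roy2001, §1] -/
theorem schanuelRank_two_false_without_channel_beyond_periods (hN : nesterenko) :
    ¬ ∀ E : ℂ → ℂ, PeriodPackage E → SchanuelRankE E 2 :=
  fun h => not_schanuelRankE_E₂_two (h _ (periodPackage_E₂ hN))

/-- Unconditional form: `SchanuelRank 2` is FALSE WITHOUT a channel beyond (E1)–(E4), the true
kernel and the period plane. [cite: Roy2001, §1] -/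
theorem schanuelRank_two_false_without_channel_beyond_kernel_and_period_plane :
    ¬ ∀ E : ℂ → ℂ, TranscendencePackage E → TrueKernel E → AgreesOnPeriodPlane E → SchanuelRankE E 2 :=
  fun h => not_schanuelRankE_E₂_two (h _ transcendencePackage_E₂ trueKernel_E₂ agreesOnPeriodPlane_E₂)

/-- Unconditional form for the crux: `KleinPolarSchanuel` is FALSE WITHOUT a channel beyond
(E1)–(E4), the true kernel and the period plane (part PKF02's headline needed `nesterenko` to BUILD
its model; `E₂` does not). [folklore] -/
theorem kleinPolarSchanuel_false_without_channel_beyond_kernel_and_period_plane :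
    ¬ ∀ E : ℂ → ℂ, TranscendencePackage E → TrueKernel E → AgreesOnPeriodPlane E → KleinPolarE E :=
  fun h => not_kleinPolarE_E₂ (h _ transcendencePackage_E₂ trueKernel_E₂ agreesOnPeriodPlane_E₂)

/-- **`KleinPolarSchanuel` is FALSE WITHOUT a channel beyond ANY FINITE PINNING**: for every
finite-dimensional `A`-subspace `F ⊂ ℝ`, not every exponential with the period package that agrees
with `exp` on `F ⊕ iF` satisfies Klein-polar Schanuel. [cite: Baker1966, 68] -/
theorem kleinPolarSchanuel_false_without_channel_beyond_finite_pinning (hN : nesterenko)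
    (F : Submodule A ℝ) [Module.Finite A F] :
    ¬ ∀ E : ℂ → ℂ, PeriodPackage E → AgreesOn E F → KleinPolarE E := by
  obtain ⟨E, hP, hA, _, _, _, hX, _⟩ := finitePinningFloor_periodPackage hN F
  exact fun h => hX (h E hP hA)

/-- **`KleinPolarSchanuel` is FALSE WITHOUT a channel beyond HYPERPLANE PINNING**: it does not
follow from the period package plus «`E = exp` on `H ⊕ iH` for SOME `A`-hyperplane `H ⊇ F`», for
any prescribed finite-dimensional `F`. [cite: Baker1966, 68] -/
theorem kleinPolarSchanuel_false_without_channel_beyond_hyperplane_pinning (hN : nesterenko)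
    (F : Submodule A ℝ) [Module.Finite A F] :
    ¬ ∀ (E : ℂ → ℂ) (H : Submodule A ℝ) (u : ℝ), F ≤ H → H ⊔ Submodule.span A {u} = ⊤ →
      PeriodPackage E → AgreesOn E H → KleinPolarE E := by
  obtain ⟨E, H, u, hFH, _, hsup, hA, hP, _, _, _, hX, _⟩ := hyperplanePinningFloor_periodPackage hN F
  exact fun h => hX (h E H u hFH hsup hP hA)

/-- **`SchanuelRank 2` is FALSE WITHOUT a channel beyond ANY FINITE PINNING.** [cite: Baker1966, 68] -/
theorem schanuelRank_two_false_without_channel_beyond_finite_pinning (hN : nesterenko)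
    (F : Submodule A ℝ) [Module.Finite A F] :
    ¬ ∀ E : ℂ → ℂ, PeriodPackage E → AgreesOn E F → SchanuelRankE E 2 := by
  obtain ⟨E, hP, hA, _, _, hS, _, _⟩ := finitePinningFloor_periodPackage hN F
  exact fun h => hS (h E hP hA)

/-- **The summit text is FALSE WITHOUT a channel beyond ANY FINITE PINNING.** [cite: Waldschmidt2000, §1.4] -/
theorem schanuel_false_without_channel_beyond_finite_pinning (hN : nesterenko)
    (F : Submodule A ℝ) [Module.Finite A F] :
    ¬ ∀ E : ℂ → ℂ, PeriodPackage E → AgreesOn E F → SchanuelE E := by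
  obtain ⟨E, hP, hA, _, _, _, _, hS⟩ := finitePinningFloor_periodPackage hN F
  exact fun h => hS (h E hP hA)

/-- Unconditional finite-pinning form for the crux (no Nesterenko): the transcendence package, the
true kernel, the period plane and agreement with `exp` on any finite-dimensional `F ⊕ iF` do not
imply Klein-polar Schanuel. [cite: Baker1966, 68] -/
theorem kleinPolarSchanuel_false_without_channel_beyond_finite_pinning' (F : Submodule A ℝ)
    [Module.Finite A F] :
    ¬ ∀ E : ℂ → ℂ, TranscendencePackage E → TrueKernel E → AgreesOnPeriodPlane E → AgreesOn E F →
      KleinPolarE E := by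
  obtain ⟨E, h₁, h₂, h₃, h₄, _, _, _, _, hX, _⟩ := finitePinningFloor F
  exact fun h => hX (h E h₁ h₂ h₃ h₄)

/-- DICTIONARY: the genuine exponential has the period package and agrees with itself on every
`F`, and its instances of the failing statements ARE the crux `KleinPolarSchanuel`
(stmt-Schanuel-24622), the tree's `SchanuelRank 2` and the summit `Schanuel` (`Iff.rfl`) — so none
of them follows from the period package plus any finite (or hyperplane) pinning.
[cite: Waldschmidt2000, §1.4] -/
theorem finitePinning_exp_dictionary (hN : nesterenko) (F : Submodule A ℝ) :
    PeriodPackage cexp ∧ AgreesOn cexp F ∧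
      (KleinPolarE cexp ↔ Summit.Schanuel.Schanuel.Theses.RootDecomp1B.KleinPolarSchanuel) ∧
      (SchanuelRankE cexp 2 ↔ SchanuelRank 2) ∧ (SchanuelE cexp ↔ Schanuel) :=
  ⟨periodPackage_exp hN, agreesOn_exp F, kleinPolarE_exp_iff, schanuelRankE_exp_iff 2, schanuelE_exp_iff⟩

end Summit.Schanuel.Schanuel.Theorems.RootDecomp1BFinitePinningFloor

end
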